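import Summits.QuantumFields.BalabanUV.Beta.D1BFx.PeriodisedProjector
import Summits.QuantumFields.BalabanUV.Beta.D1BFx.ColumnSpaceProjector

/-!
# `BalabanUV.Beta.D1BFx.TorusGaugeWeight` — road «BF-x» for binder row D1, slot (K), `K-ASSEMBLY-SPEC-v2.md` §2 brick **K-TB3b-J «THE JUNCTION»**
# (v2.4, ruling ρ-g6-11): ON EVERY TORUS `(ℤ/s)⁴`, `s = (m+1)·p`, THE ROAD'S GAUGE WEIGHT `1 − P̂` IS THE `L̂`-GRAM PROJECTOR OF **ANY** BASIS `N` OF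
# THE BLOCK-MEAN-FREE GAUGE FUNCTIONS — `1 − P̂ = L̂N(NᵀL̂L̂N)⁻¹NᵀL̂` — HENCE FOR ANY GRADIENT-TYPE MATRIX `D` THE WEIGHT `2•D(1 − P̂)Dᵀ` IS THE
# CO-FRAME GRAM `T₀ᵀA₀T₀` OF K-TA4G (R2) WITH `T₀ := NᵀL̂Dᵀ`, `A₀ := 2•(NᵀL̂L̂N)⁻¹`, AND `T₀·(DN) = NᵀL̂L̂N` IS INVERTIBLE WHEN `DᵀD = L̂`

HONEST FRAMING (cell contract, verbatim): «discharging `BetaPertH` makes Bałaban's UV stability UNCONDITIONAL — a real constructive-QFT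
result; it is NOT the continuum limit and NOT the Clay problem.»  HONEST DEPENDENCY (verbatim): «continuum YM on T⁴ ⇐ BetaPertH ∧ nine
spine estimates (0/9 proved); BetaPertH ⇐ (D1) ∧ (D4) ∧ CAP+tail; G-an2-4 gates asym, D1 and NE2/3/4.»  THIS MODULE DISCHARGES NOTHING of
D1 / BetaPertH: [folklore] finite linear algebra BY NAME over this lineage's `PeriodisedProjector` (gen 5, X1-Q3b part 2: `Rhat_transpose`,
`Rhat_mul_Rhat`, `Rhat_mulVec_eq_self_iff`, `Ghat_Lhat_mulVec`) and gan24-leaf-01-g48's `ColumnSpaceProjector` (K-TB3b-GEN: the socket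
`eq_colProj_comp_of_kernel_range_symm`, `gram_junction`, `isUnit_det_two_smul_inv`).  No `def`, no `def … : Prop`, nothing cited, 0 sorry.
The basis `N` is a DISPLAYED argument with its two facts `hN` (its range is `ker Ŝ`) and `hNinj` (injective); the canonical comb-slice basis
`Nhat` of K-TB3b FILE 1 (leaf-03-g8's `TorusGaugeBasis`) instantiates them by name.  NOT summit progress; NOT BetaPertH, NOT continuum, NOT Clay.

ABSOLUTE RULE (cell, verbatim): «No internally-minted statement may enter as a cited fact. Every hypothesis is either kernel-proved in this
package or a verbatim quotation of a PUBLISHED theorem with page reference. The manuscript(s) under audit are NOT citable for their own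
disputed steps — they are the thing under adjudication; programme-internal (2001/route/tribunal) claims are never citable.»

CONTENT (`m`, `a > 0`, fine period `s = (m+1)·p`; `P̂ = Phat m a s`, `L̂ = Lhat s`, `Ŝ = Shat m s` of `PeriodisedProjector`; all [folklore]).
* §1 `Lhat_transpose` (`L̂ᵀ = L̂`), **`eq_zero_of_Shat_of_Lhat`** (`Ŝλ = 0 → L̂λ = 0 → λ = 0`, from `Ĝ′L̂λ = (m+1)⁻²λ` — no connectivity argument).
* §2 **`junction`**: for any `N : Matrix (Site 4 s) ρ ℝ` with `(Ŝλ = 0 ↔ λ ∈ range N)` and `N` injective,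
  `IsUnit (NᵀL̂L̂N).det ∧ 1 − P̂ = L̂N(NᵀL̂L̂N)⁻¹NᵀL̂`.
* §3 the weight datum of K-TA4G (R2) for any `D : Matrix β (Site 4 s) ℝ`: **`two_smul_weight_eq_gram`**
  (`2•(D(1 − P̂)Dᵀ) = (NᵀL̂Dᵀ)ᵀ(2•(NᵀL̂L̂N)⁻¹)(NᵀL̂Dᵀ)`), `coframe_mul_basis` (`(NᵀL̂Dᵀ)(DN) = NᵀL̂L̂N` when `DᵀD = L̂`), `isUnit_det_weightA`,
  `det_coframe_mul_basis_ne_zero`, `det_weightA_ne_zero`.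
* §4 re-indexed (sorted-currency) forms for any `e : ν → β` ∕ `e : ν ≃ β`: `submatrix_sandwich`, **`two_smul_weight_submatrix_eq_gram`**,
  `submatrix_transpose_mul_submatrix`, `coframe_mul_basis_submatrix`, `det_coframe_mul_basis_submatrix_ne_zero`.
Unit `b2b-balaban-beta-d1-p2` (road owner, gen 6).
-/

noncomputable section

namespace Summit.QuantumFields.BalabanUV.Beta.D1BFx.TorusGaugeWeight

open Matrix
open scoped BigOperators
open Literature.MathematicalPhysics.QuantumFieldTheory.Balaban1983to89
open Literature.MathematicalPhysics.QuantumFieldTheory.Balaban1983to89.Beta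
open B6QGQLower276 (lapKer lapKer_symm)
open Summit.QuantumFields.BalabanUV.Beta.D1BFx.PeriodisedKernels
open Summit.QuantumFields.BalabanUV.Beta.D1BFx.PeriodisedProjector (Phat Lhat Shat Ghat Lhat_apply Ghat_Lhat_mulVec
  Rhat_mulVec_eq_self_iff Rhat_mul_Rhat Rhat_transpose)
open Summit.QuantumFields.BalabanUV.Beta.D1BFx.ColumnSpaceProjector (eq_colProj_comp_of_kernel_range_symm gram_junction
  isUnit_det_two_smul_inv)

variable {m p s : ℕ} [NeZero s] {a : ℝ}

/-! ## §1 `L̂ᵀ = L̂`, and `L̂` is injective on block-mean-free functions -/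

/-- [folklore] **`L̂ᵀ = L̂`** (the periodised matrix of the symmetric kernel `−Δ`). -/
theorem Lhat_transpose : (Lhat s)ᵀ = Lhat s := by
  ext x z
  rw [Matrix.transpose_apply, Lhat_apply, Lhat_apply]
  exact (periodise₂_symm (isPeriodic₂_lapKer s) (fun p q => lapKer_symm p q) x z).symm

/-- [folklore] **`L̂` IS INJECTIVE ON `ker Ŝ`** (no connectivity argument): `Ŝλ = 0`, `L̂λ = 0` ⟹ `λ = (m+1)²·Ĝ′L̂λ = 0`. -/
theorem eq_zero_of_Shat_of_Lhat (ha : 0 < a) (hs : s = (m + 1) * p) {lam : Site 4 s → ℝ}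
    (hS : Shat m s *ᵥ lam = 0) (hL : Lhat s *ᵥ lam = 0) : lam = 0 := by
  have h := Ghat_Lhat_mulVec ha hs hS
  rw [hL, Matrix.mulVec_zero] at h
  have hm : (((m : ℝ) + 1) ^ 2)⁻¹ ≠ 0 := by positivity
  exact (smul_eq_zero.mp h.symm).resolve_left hm

/-! ## §2 The junction: `1 − P̂` is the `L̂`-Gram projector of any basis of `ker Ŝ` -/

section Junction

variable {ρ : Type*} [Fintype ρ] [DecidableEq ρ]

/-- [folklore] **THE JUNCTION (K-TB3b-J).**  For ANY matrix `N` whose columns are a basis of the block-mean-free functions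
(`Ŝλ = 0 ↔ λ ∈ range N`, `N` injective): the Gram `NᵀL̂L̂N` is invertible and **`1 − P̂ = L̂N(NᵀL̂L̂N)⁻¹NᵀL̂`**
(`ColumnSpaceProjector.eq_colProj_comp_of_kernel_range_symm` fed with `PeriodisedProjector.Rhat_transpose ∕ Rhat_mul_Rhat ∕ Rhat_mulVec_eq_self_iff`
and §1). -/
theorem junction (ha : 0 < a) (hs : s = (m + 1) * p) {N : Matrix (Site 4 s) ρ ℝ}
    (hN : ∀ lam : Site 4 s → ℝ, Shat m s *ᵥ lam = 0 ↔ ∃ c : ρ → ℝ, lam = N *ᵥ c)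
    (hNinj : Function.Injective N.mulVec) :
    IsUnit (Nᵀ * Lhat s * Lhat s * N).det ∧
      1 - Phat m a s = Lhat s * N * (Nᵀ * Lhat s * Lhat s * N)⁻¹ * Nᵀ * Lhat s :=
  eq_colProj_comp_of_kernel_range_symm (Rhat_transpose ha hs) (Rhat_mul_Rhat ha hs) Lhat_transpose
    (Rhat_mulVec_eq_self_iff ha hs) hN hNinj (fun _ hS hL => eq_zero_of_Shat_of_Lhat ha hs hS hL)

/-- [folklore] The Gram `NᵀL̂L̂N` is invertible. -/
theorem isUnit_det_gram (ha : 0 < a) (hs : s = (m + 1) * p) {N : Matrix (Site 4 s) ρ ℝ}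
    (hN : ∀ lam : Site 4 s → ℝ, Shat m s *ᵥ lam = 0 ↔ ∃ c : ρ → ℝ, lam = N *ᵥ c)
    (hNinj : Function.Injective N.mulVec) : IsUnit (Nᵀ * Lhat s * Lhat s * N).det :=
  (junction ha hs hN hNinj).1

/-- [folklore] `1 − P̂ = L̂N(NᵀL̂L̂N)⁻¹NᵀL̂`. -/
theorem Rhat_eq_gramProj (ha : 0 < a) (hs : s = (m + 1) * p) {N : Matrix (Site 4 s) ρ ℝ}
    (hN : ∀ lam : Site 4 s → ℝ, Shat m s *ᵥ lam = 0 ↔ ∃ c : ρ → ℝ, lam = N *ᵥ c)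
    (hNinj : Function.Injective N.mulVec) :
    1 - Phat m a s = Lhat s * N * (Nᵀ * Lhat s * Lhat s * N)⁻¹ * Nᵀ * Lhat s :=
  (junction ha hs hN hNinj).2

/-! ## §3 The weight datum `(T₀, A₀, W₀) = (NᵀL̂Dᵀ, 2•(NᵀL̂L̂N)⁻¹, DN)` of K-TA4G (R2) -/

variable {β : Type*} [Fintype β]

omit [Fintype β] in
/-- [folklore] **THE WEIGHT IN CO-FRAME GRAM FORM**: for any `D : Matrix β (Site 4 s) ℝ`,
`2•(D(1 − P̂)Dᵀ) = (NᵀL̂Dᵀ)ᵀ · (2•(NᵀL̂L̂N)⁻¹) · (NᵀL̂Dᵀ)` — i.e. `gram₀ T₀ A₀` with `T₀ := NᵀL̂Dᵀ`, `A₀ := 2•(NᵀL̂L̂N)⁻¹`. -/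
theorem two_smul_weight_eq_gram (ha : 0 < a) (hs : s = (m + 1) * p) {N : Matrix (Site 4 s) ρ ℝ}
    (hN : ∀ lam : Site 4 s → ℝ, Shat m s *ᵥ lam = 0 ↔ ∃ c : ρ → ℝ, lam = N *ᵥ c)
    (hNinj : Function.Injective N.mulVec) (D : Matrix β (Site 4 s) ℝ) :
    (2 : ℝ) • (D * (1 - Phat m a s) * Dᵀ)
      = (Nᵀ * Lhat s * Dᵀ)ᵀ * ((2 : ℝ) • (Nᵀ * Lhat s * Lhat s * N)⁻¹) * (Nᵀ * Lhat s * Dᵀ) := by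
  rw [Rhat_eq_gramProj ha hs hN hNinj, Matrix.transpose_mul, Matrix.transpose_mul, Matrix.transpose_transpose,
    Lhat_transpose]
  simp only [Matrix.transpose_transpose, Matrix.mul_smul, Matrix.smul_mul, Matrix.mul_assoc]

omit [Fintype ρ] [DecidableEq ρ] in
/-- [folklore] **CO-FRAME × BASIS = THE GRAM**: `(NᵀL̂Dᵀ)·(DN) = NᵀL̂L̂N` whenever `DᵀD = L̂` (`ColumnSpaceProjector.gram_junction`). -/
theorem coframe_mul_basis {N : Matrix (Site 4 s) ρ ℝ} {D : Matrix β (Site 4 s) ℝ} (hD : Dᵀ * D = Lhat s) :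
    Nᵀ * Lhat s * Dᵀ * (D * N) = Nᵀ * Lhat s * Lhat s * N :=
  gram_junction hD

/-- [folklore] **`A₀ := 2•(NᵀL̂L̂N)⁻¹` IS INVERTIBLE** (the `hA` of K-TA4G). -/
theorem isUnit_det_weightA (ha : 0 < a) (hs : s = (m + 1) * p) {N : Matrix (Site 4 s) ρ ℝ}
    (hN : ∀ lam : Site 4 s → ℝ, Shat m s *ᵥ lam = 0 ↔ ∃ c : ρ → ℝ, lam = N *ᵥ c)
    (hNinj : Function.Injective N.mulVec) : IsUnit ((2 : ℝ) • (Nᵀ * Lhat s * Lhat s * N)⁻¹).det :=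
  isUnit_det_two_smul_inv (isUnit_det_gram ha hs hN hNinj)

/-- [folklore] `det A₀ ≠ 0`. -/
theorem det_weightA_ne_zero (ha : 0 < a) (hs : s = (m + 1) * p) {N : Matrix (Site 4 s) ρ ℝ}
    (hN : ∀ lam : Site 4 s → ℝ, Shat m s *ᵥ lam = 0 ↔ ∃ c : ρ → ℝ, lam = N *ᵥ c)
    (hNinj : Function.Injective N.mulVec) : ((2 : ℝ) • (Nᵀ * Lhat s * Lhat s * N)⁻¹).det ≠ 0 :=
  (isUnit_det_weightA ha hs hN hNinj).ne_zero

/-- [folklore] **`det (T₀·W₀) ≠ 0`** (the `hT` of K-TA4G): `det((NᵀL̂Dᵀ)(DN)) ≠ 0` whenever `DᵀD = L̂`. -/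
theorem det_coframe_mul_basis_ne_zero (ha : 0 < a) (hs : s = (m + 1) * p) {N : Matrix (Site 4 s) ρ ℝ}
    (hN : ∀ lam : Site 4 s → ℝ, Shat m s *ᵥ lam = 0 ↔ ∃ c : ρ → ℝ, lam = N *ᵥ c)
    (hNinj : Function.Injective N.mulVec) {D : Matrix β (Site 4 s) ℝ} (hD : Dᵀ * D = Lhat s) :
    (Nᵀ * Lhat s * Dᵀ * (D * N)).det ≠ 0 := by
  rw [coframe_mul_basis hD]
  exact (isUnit_det_gram ha hs hN hNinj).ne_zero

/-! ## §4 Re-indexed forms (the sorted currency `ν` of TB5: `D ↦ D.submatrix e id`) -/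

variable {ν : Type*} [Fintype ν]

omit [Fintype ρ] [DecidableEq ρ] [Fintype β] [Fintype ν] in
/-- [folklore] **SANDWICH RE-INDEXING**: `(D·M·Dᵀ).submatrix e e = (D.submatrix e id)·M·(D.submatrix e id)ᵀ` for ANY map `e : ν → β`. -/
theorem submatrix_sandwich (D : Matrix β (Site 4 s) ℝ) (M : Matrix (Site 4 s) (Site 4 s) ℝ) (e : ν → β) :
    (D * M * Dᵀ).submatrix e e = D.submatrix e id * M * (D.submatrix e id)ᵀ := by
  ext i j
  simp only [Matrix.submatrix_apply, Matrix.mul_apply, Matrix.transpose_apply, id]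

omit [Fintype β] [Fintype ν] in
/-- [folklore] **THE WEIGHT IN CO-FRAME GRAM FORM, RE-INDEXED**: for any `e : ν → β`,
`2•(D(1 − P̂)Dᵀ).submatrix e e = T₀ᵀ·A₀·T₀` with `T₀ := NᵀL̂(D.submatrix e id)ᵀ`, `A₀ := 2•(NᵀL̂L̂N)⁻¹`. -/
theorem two_smul_weight_submatrix_eq_gram (ha : 0 < a) (hs : s = (m + 1) * p) {N : Matrix (Site 4 s) ρ ℝ}
    (hN : ∀ lam : Site 4 s → ℝ, Shat m s *ᵥ lam = 0 ↔ ∃ c : ρ → ℝ, lam = N *ᵥ c)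
    (hNinj : Function.Injective N.mulVec) (D : Matrix β (Site 4 s) ℝ) (e : ν → β) :
    (2 : ℝ) • (D * (1 - Phat m a s) * Dᵀ).submatrix e e
      = (Nᵀ * Lhat s * (D.submatrix e id)ᵀ)ᵀ * ((2 : ℝ) • (Nᵀ * Lhat s * Lhat s * N)⁻¹)
          * (Nᵀ * Lhat s * (D.submatrix e id)ᵀ) := by
  rw [submatrix_sandwich, two_smul_weight_eq_gram ha hs hN hNinj]

omit [NeZero s] [Fintype ρ] [DecidableEq ρ] in
/-- [folklore] **A BIJECTIVE RE-INDEXING KEEPS `DᵀD`**: `(D.submatrix e id)ᵀ·(D.submatrix e id) = DᵀD` for `e : ν ≃ β`. -/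
theorem submatrix_transpose_mul_submatrix (D : Matrix β (Site 4 s) ℝ) (e : ν ≃ β) :
    (D.submatrix e id)ᵀ * D.submatrix e id = Dᵀ * D := by
  rw [Matrix.transpose_submatrix]
  have h := Matrix.submatrix_mul_equiv Dᵀ D (id : Site 4 s → Site 4 s) e (id : Site 4 s → Site 4 s)
  rw [Matrix.submatrix_id_id] at h
  exact h

omit [Fintype ρ] [DecidableEq ρ] in
/-- [folklore] `T₀·W₀ = NᵀL̂L̂N` in the re-indexed currency (`e : ν ≃ β`, `DᵀD = L̂`). -/
theorem coframe_mul_basis_submatrix {N : Matrix (Site 4 s) ρ ℝ} {D : Matrix β (Site 4 s) ℝ} (hD : Dᵀ * D = Lhat s)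
    (e : ν ≃ β) :
    Nᵀ * Lhat s * (D.submatrix e id)ᵀ * (D.submatrix e id * N) = Nᵀ * Lhat s * Lhat s * N :=
  coframe_mul_basis (by rw [submatrix_transpose_mul_submatrix, hD])

/-- [folklore] **`det (T₀·W₀) ≠ 0`** in the re-indexed currency. -/
theorem det_coframe_mul_basis_submatrix_ne_zero (ha : 0 < a) (hs : s = (m + 1) * p) {N : Matrix (Site 4 s) ρ ℝ}
    (hN : ∀ lam : Site 4 s → ℝ, Shat m s *ᵥ lam = 0 ↔ ∃ c : ρ → ℝ, lam = N *ᵥ c)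
    (hNinj : Function.Injective N.mulVec) {D : Matrix β (Site 4 s) ℝ} (hD : Dᵀ * D = Lhat s) (e : ν ≃ β) :
    (Nᵀ * Lhat s * (D.submatrix e id)ᵀ * (D.submatrix e id * N)).det ≠ 0 := by
  rw [coframe_mul_basis_submatrix hD e]
  exact (isUnit_det_gram ha hs hN hNinj).ne_zero

end Junction

end Summit.QuantumFields.BalabanUV.Beta.D1BFx.TorusGaugeWeight

end
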